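import Literature.NumberTheory.Transcendental.TorusZeroEstimateProofs
import Literature.NumberTheory.Transcendental.PerturbedGridRelations
import Literature.NumberTheory.Transcendental.OmegaDegree
import HarnessLib

/-!
# Condition (Z.E.) from the Technical Hypothesis (LNM 1752, Ch. 14, Proposition 3.6), proved

Topic `Literature/NumberTheory/Transcendental`. Decomposition step for the proofs of "large
transcendence degree" in Nesterenko–Philippon (eds.), LNM 1752, Ch. 14 (M. Waldschmidt), §3, and
for the barrier record `Literature.Barriers.Schanuel.LargeTranscendenceDegree` (Theorem 2.7 there).
This file PROVES Proposition 3.6 of loc. cit. (§3.2.3 c) "Single Variable: n = 1") from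
Philippon's zero estimate on `𝔾ₘ^d` — the tree's named fact `Philippon1986_zeroEstimate_torus`
(`TorusZeroEstimate.lean`), through its interface `Philippon1986_zeroEstimate_torus.exists_char`
(`TorusZeroEstimateProofs.lean`) — and Lemma 3.5 (`prod_zpow_ne_one_of_technicalHypothesis`,
`PerturbedGridRelations.lean`, proved). No new definitions: the conclusion of condition (Z.E.)
(Definition 3.4) is spelled out with `omegaDeg` (`OmegaDegree.lean`).

Printed statements (PDF pp. 252–254, verbatim up to notation).

DEFINITION 3.4 (n = 1). … `(X, Y)` satisfies the condition (Z.E.) if for each `η > 0` there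
exists `R₀ > 0` with the following property: for any positive integer `R ≥ R₀` and any `q`-tuple
`(μ₁, …, μ_q)` of complex numbers satisfying `max_h |θ_h - μ_h| < e^{-R^η}` (the `θ_h` being the
distinct values of the `e^{xᵢyⱼ}`), if we set `μᵢⱼ = μ_h` for `e^{xᵢyⱼ} = θ_h` and
`Σ = {(∏ⱼ μᵢⱼ^{rⱼ})_{1≤i≤d} ; 0 ≤ rⱼ < R (1 ≤ j ≤ ℓ)} ⊂ (ℂˣ)^d`, then `ω(Σ) ≥ (R/d)^{ℓ/d}`.

PROPOSITION 3.6. Let `x₁, …, x_d` in `ℝ` satisfy (T.H.), and let `y₁, …, y_ℓ` in `ℝ` also satisfy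
(T.H.). Let `X = ℤx₁ + ⋯ + ℤx_d` and `Y = ℤy₁ + ⋯ + ℤy_ℓ`. Then `(X, Y)` satisfies the condition
(Z.E.).

What is proved (`omegaDeg_perturbedGrid_ge`): under (T.H.) for the real tuples `x`, `y` and
`d ≥ 1`, for every `η > 0` there is `R₀` such that for all integers `R ≥ R₀` and ALL complex
`μᵢⱼ` with `|e^{xᵢyⱼ} - μᵢⱼ| < e^{-R^η}`, `ω(Σ) ≥ (R/d)^{ℓ/d}` for
`Σ = {(∏ⱼ μᵢⱼ^{rⱼ})ᵢ ; 0 ≤ rⱼ < R}` — i.e. the conclusion of (Z.E.) without even imposing the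
consistency constraint `μᵢⱼ = μ_h` of Definition 3.4 (the printed proof never uses it), which is
formally stronger. `d ≥ 1` is the source's standing "`X` of rank `d`" (for `d = 0` the encoded
inequality would read `1 ≤ 0`).

Proof as printed (p. 254), with the two points the text leaves implicit made explicit:
suppose `ω(Σ) = D < (R/d)^{ℓ/d}` and let `P ≠ 0` of degree `D` vanish on `Σ` (`omegaDeg_spec`).
With `N = ⌈R/d⌉` and `Σ₀ = {σ_r ; rⱼ < N} ∋ e`, products of `d` points of `Σ₀` have exponents
`≤ d(N-1) < R`, so `P` vanishes on `Σ₀(d) ⊆ Σ` and the zero estimate yields `λ ∈ ℤ^d ∖ 0`,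
`max|λᵢ| ≤ D`, such that `λ`-separated subsets of `Σ₀` have `≤ D^d` elements (`exists_char`).
By Lemma 3.5 — applied with `η₀ = ηd/(ℓ+d)` and `L = max(L₀, D)` (the text takes `L = D`; one
needs `L ≥ L₀`, and `L ≤ R^{ℓ/d}` still gives `(LR)^{η₀} ≤ R^η`) — all of `Σ₀` is `λ`-separated
and `r ↦ σ_r` is injective on the box, so `N^ℓ = #Σ₀ ≤ D^d < (R/d)^ℓ ≤ N^ℓ`, a contradiction. The
thresholds on `R` are: `R ≥ R₀` of Lemma 3.5, `R ≥ L₀^{d/ℓ}`, and `R^η ≥ 1 + ∑|xᵢyⱼ|` (which makes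
every `μᵢⱼ ≠ 0`, so that `Σ ⊂ (ℂˣ)^d`).

## References

* Yu. V. Nesterenko, P. Philippon (eds.), *Introduction to Algebraic Independence Theory*,
  LNM 1752, Springer 2001, Ch. 14 (M. Waldschmidt), §3.2.3: Definition 3.4 (PDF p. 252), Lemma 3.5
  (p. 253), Proposition 3.6 and its proof (pp. 253–254); Ch. 11 (D. Roy), Theorem 4.1 (p. 218).
* P. Philippon, *Lemmes de zéros dans les groupes algébriques commutatifs*, Bull. Soc. Math.
  France 114 (1986), 355–383, Théorème 2.1 (the zero estimate behind `Philippon1986_zeroEstimate_torus`).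
-/

noncomputable section

open Finset Complex

namespace Literature.NumberTheory.Transcendental

namespace PerturbedGrid

open Torus

variable {d l : ℕ}

/-! ### Grid points in the torus `(ℂˣ)^d` -/

/-- Additivity of `r ↦ σ_r = (∏ⱼ νᵢⱼ^{rⱼ})ᵢ` in the exponent. [folklore] -/
theorem torusGrid_add (ν : Fin d → Fin l → ℂˣ) (r r' : Fin l → ℕ) :
    (fun i => ∏ j, ν i j ^ (r + r') j : Torus d) =
      (fun i => ∏ j, ν i j ^ r j) * (fun i => ∏ j, ν i j ^ r' j) := by
  ext i
  simp only [Pi.add_apply, pow_add, prod_mul_distrib, Pi.mul_apply, Units.val_mul]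

/-- `σ_{∑ₘ rₘ} = ∏ₘ σ_{rₘ}`. [folklore] -/
theorem torusGrid_sum (ν : Fin d → Fin l → ℂˣ) {k : ℕ} (r : Fin k → Fin l → ℕ) :
    (fun i => ∏ j, ν i j ^ (∑ m, r m) j : Torus d) = ∏ m, (fun i => ∏ j, ν i j ^ (r m) j) := by
  induction k with
  | zero => ext i; simp
  | succ k ih => rw [Fin.sum_univ_castSucc, Fin.prod_univ_castSucc, torusGrid_add, ih]

/-- The value of the character `χ_a` at `σ_r⁻¹ σ_{r'}` is `∏ᵢ ∏ⱼ νᵢⱼ^{aᵢ(r'ⱼ - rⱼ)}`. [folklore] -/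
theorem coe_char_torusGrid_inv_mul (ν : Fin d → Fin l → ℂˣ) (a : Fin d → ℤ) (r r' : Fin l → ℕ) :
    ((char a ((fun i => ∏ j, ν i j ^ r j : Torus d)⁻¹ * (fun i => ∏ j, ν i j ^ r' j)) : ℂˣ) : ℂ) =
      ∏ i, ∏ j, (ν i j : ℂ) ^ (a i * ((r' j : ℤ) - r j)) := by
  rw [char_apply, Units.coe_prod]
  refine prod_congr rfl fun i _ => ?_
  have h1 : ((fun i => ∏ j, ν i j ^ r j : Torus d)⁻¹ * (fun i => ∏ j, ν i j ^ r' j)) i =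
      ∏ j, ν i j ^ ((r' j : ℤ) - r j) := by
    simp only [Pi.mul_apply, Pi.inv_apply]
    rw [← prod_inv_distrib, ← prod_mul_distrib]
    refine prod_congr rfl fun j _ => ?_
    rw [zpow_sub, zpow_natCast, zpow_natCast, mul_comm]
  rw [h1, ← prod_zpow, Units.coe_prod]
  refine prod_congr rfl fun j _ => ?_
  rw [Units.val_zpow_eq_zpow_val, Units.val_zpow_eq_zpow_val, ← zpow_mul, mul_comm]

/-- The grid `Σ_R = {(∏ⱼ μᵢⱼ^{rⱼ})ᵢ ; rⱼ < R}` is finite. [folklore] -/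
theorem gridSet_finite (μ : Fin d → Fin l → ℂ) (R : ℕ) :
    {p : Fin d → ℂ | ∃ r : Fin l → ℕ, (∀ j, r j < R) ∧ p = fun i => ∏ j, μ i j ^ r j}.Finite := by
  classical
  refine (((Fintype.piFinset fun _ : Fin l => range R).image
    (fun r : Fin l → ℕ => fun i => ∏ j, μ i j ^ r j)).finite_toSet).subset ?_
  rintro p ⟨r, hr, rfl⟩
  simp only [coe_image, Set.mem_image, mem_coe, Fintype.mem_piFinset, mem_range]
  exact ⟨r, hr, rfl⟩

/-- Exponent bookkeeping of the proof of Prop. 3.6: `(ℓ/d + 1) · (ηd/(ℓ+d)) = η`. [folklore] -/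
theorem exponent_identity (hd : 1 ≤ d) (η : ℝ) :
    ((l : ℝ) / d + 1) * (η * d / (l + d)) = η := by
  have hd0 : (d : ℝ) ≠ 0 := by exact_mod_cast (show d ≠ 0 by omega)
  have hld : (l : ℝ) + d ≠ 0 := by
    have : (0 : ℝ) ≤ l := Nat.cast_nonneg l
    have : (1 : ℝ) ≤ d := by exact_mod_cast hd
    linarith
  field_simp

end PerturbedGrid

open PerturbedGrid Torus in
/-- **LNM 1752, Ch. 14, Proposition 3.6 (condition (Z.E.) for `n = 1` from the Technical
Hypothesis)**, conditional on Philippon's zero estimate on `𝔾ₘ^d`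
(`Philippon1986_zeroEstimate_torus`). Let `d ≥ 1` and let `x₁, …, x_d`, `y₁, …, y_ℓ` be real
numbers, each tuple satisfying (T.H.). For every `η > 0` there is `R₀` such that for all integers
`R ≥ R₀` and all complex `μᵢⱼ` with `|e^{xᵢyⱼ} - μᵢⱼ| < e^{-R^η}`, every nonzero polynomial
vanishing on `Σ = {(∏ⱼ μᵢⱼ^{rⱼ})ᵢ ; 0 ≤ rⱼ < R}` has total degree `≥ (R/d)^{ℓ/d}`, i.e.
`ω(Σ) ≥ (R/d)^{ℓ/d}`. PROVED from the named fact and Lemma 3.5 (see the module docstring).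
[cite: NesterenkoPhilippon2001, Ch. 14 Prop. 3.6 and its proof, PDF pp. 253–254] -/
theorem omegaDeg_perturbedGrid_ge (hZ : Philippon1986_zeroEstimate_torus) {d l : ℕ}
    (hd : 1 ≤ d) {x : Fin d → ℝ} {y : Fin l → ℝ}
    (hx : TechnicalHypothesis fun i => (x i : ℂ)) (hy : TechnicalHypothesis fun j => (y j : ℂ))
    {η : ℝ} (hη : 0 < η) :
    ∃ R₀ : ℕ, ∀ R : ℕ, R₀ ≤ R → ∀ μ : Fin d → Fin l → ℂ,
      (∀ i j, ‖exp ((x i : ℂ) * y j) - μ i j‖ < Real.exp (-(R : ℝ) ^ η)) →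
      ((R : ℝ) / d) ^ ((l : ℝ) / d) ≤
        omegaDeg {p : Fin d → ℂ | ∃ r : Fin l → ℕ, (∀ j, r j < R) ∧ p = fun i => ∏ j, μ i j ^ r j} := by
  classical
  haveI : Nonempty (Fin d) := ⟨⟨0, hd⟩⟩
  have hd0 : (0 : ℝ) < d := by exact_mod_cast hd
  -- the exponent of Lemma 3.5
  set η₀ : ℝ := η * d / (l + d) with hη₀
  have hη₀0 : 0 < η₀ := by rw [hη₀]; positivity
  obtain ⟨L₀, R₀, h35⟩ := prod_zpow_ne_one_of_technicalHypothesis hx hy hη₀0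
  -- thresholds on `R`
  set A : ℝ := ∑ i, ∑ j, |x i * y j| with hA
  have hA0 : 0 ≤ A := sum_nonneg fun _ _ => sum_nonneg fun _ _ => abs_nonneg _
  set R₁ : ℕ := max (max R₀ 1) ⌈max ((L₀ : ℝ) ^ ((d : ℝ) / l)) ((A + 1) ^ (1 / η))⌉₊ with hR₁
  refine ⟨R₁, fun R hR μ hμ => ?_⟩
  have hRR₀ : R₀ ≤ R := ((le_max_left _ _).trans (le_max_left _ _)).trans hR
  have hR1 : 1 ≤ R := ((le_max_right _ _).trans (le_max_left _ _)).trans hR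
  have hR1' : (1 : ℝ) ≤ R := by exact_mod_cast hR1
  have hR0 : (0 : ℝ) < R := by linarith
  have hRceil : max ((L₀ : ℝ) ^ ((d : ℝ) / l)) ((A + 1) ^ (1 / η)) ≤ R :=
    (Nat.le_ceil _).trans (by exact_mod_cast (le_max_right _ _).trans hR)
  -- (a) `R^η ≥ A + 1`, hence every `μᵢⱼ ≠ 0`
  have hRη : A + 1 ≤ (R : ℝ) ^ η := by
    have h1 : (A + 1) ^ (1 / η) ≤ (R : ℝ) := (le_max_right _ _).trans hRceil
    calc A + 1 = ((A + 1) ^ (1 / η)) ^ η := by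
          rw [← Real.rpow_mul (by linarith), one_div_mul_cancel hη.ne', Real.rpow_one]
      _ ≤ (R : ℝ) ^ η := Real.rpow_le_rpow (Real.rpow_nonneg (by linarith) _) h1 hη.le
  have hμ0 : ∀ i j, μ i j ≠ 0 := by
    intro i j h0
    have h1 := hμ i j
    rw [h0, sub_zero, norm_exp] at h1
    have h2 : ((x i : ℂ) * y j).re = x i * y j := by
      rw [← ofReal_mul, ofReal_re]
    rw [h2, Real.exp_lt_exp] at h1
    have h3 : |x i * y j| ≤ A :=
      (single_le_sum (f := fun j' => |x i * y j'|) (fun _ _ => abs_nonneg _) (mem_univ j)).trans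
        (single_le_sum (f := fun i' => ∑ j', |x i' * y j'|)
          (fun _ _ => sum_nonneg fun _ _ => abs_nonneg _) (mem_univ i))
    have h4 : -(x i * y j) ≤ |x i * y j| := neg_le_abs _
    linarith
  -- the units `νᵢⱼ` and the torus points `σ_r`
  set ν : Fin d → Fin l → ℂˣ := fun i j => Units.mk0 (μ i j) (hμ0 i j) with hν
  have hνμ : ∀ i j, ((ν i j : ℂˣ) : ℂ) = μ i j := fun i j => rfl
  set σu : (Fin l → ℕ) → Torus d := fun r i => ∏ j, ν i j ^ r j with hσu
  have hcoeσ : ∀ r : Fin l → ℕ, (fun i => ((σu r i : ℂˣ) : ℂ)) = fun i => ∏ j, μ i j ^ r j := by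
    intro r; funext i
    simp [hσu, hν, Units.coe_prod]
  -- the set `Σ_R` and the contradiction hypothesis
  set Sig : Set (Fin d → ℂ) :=
    {p | ∃ r : Fin l → ℕ, (∀ j, r j < R) ∧ p = fun i => ∏ j, μ i j ^ r j} with hSig
  have hSigfin : Sig.Finite := gridSet_finite μ R
  by_contra hlt
  rw [not_le] at hlt
  obtain ⟨P, hP0, hPv, hPdeg⟩ := omegaDeg_spec (K := ℂ) hSigfin
  set D : ℕ := omegaDeg Sig with hDdef
  have hDlt : (D : ℝ) < ((R : ℝ) / d) ^ ((l : ℝ) / d) := hlt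
  -- (b) `D ≤ R^{ℓ/d}`, `L₀ ≤ R^{ℓ/d}` (for `ℓ ≠ 0`), so `L := max L₀ D ≤ R^{ℓ/d}`
  have hRd : (R : ℝ) / d ≤ R := div_le_self hR0.le (by exact_mod_cast hd)
  have hRdnn : (0 : ℝ) ≤ (R : ℝ) / d := by positivity
  have hld : (0 : ℝ) ≤ (l : ℝ) / d := by positivity
  have hDle : (D : ℝ) ≤ (R : ℝ) ^ ((l : ℝ) / d) :=
    hDlt.le.trans (Real.rpow_le_rpow hRdnn hRd hld)
  set L : ℕ := max L₀ D with hL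
  have hLle : l ≠ 0 → (L : ℝ) ≤ (R : ℝ) ^ ((l : ℝ) / d) := by
    intro hl
    have hl0 : (0 : ℝ) < l := by exact_mod_cast Nat.pos_of_ne_zero hl
    have hL₀le : (L₀ : ℝ) ≤ (R : ℝ) ^ ((l : ℝ) / d) := by
      have h1 : (L₀ : ℝ) ^ ((d : ℝ) / l) ≤ R := (le_max_left _ _).trans hRceil
      calc (L₀ : ℝ) = ((L₀ : ℝ) ^ ((d : ℝ) / l)) ^ ((l : ℝ) / d) := by
            rw [← Real.rpow_mul (Nat.cast_nonneg L₀), div_mul_div_comm, mul_comm (d : ℝ) l,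
              div_self (by positivity), Real.rpow_one]
        _ ≤ (R : ℝ) ^ ((l : ℝ) / d) :=
            Real.rpow_le_rpow (Real.rpow_nonneg (Nat.cast_nonneg _) _) h1 hld
    rw [hL]; push_cast
    exact max_le hL₀le hDle
  -- (c) closeness at the scale of Lemma 3.5: `e^{-R^η} ≤ e^{-(LR)^{η₀}}` (for `ℓ ≠ 0`)
  have hscale : l ≠ 0 → Real.exp (-(R : ℝ) ^ η) ≤ Real.exp (-((L : ℝ) * R) ^ η₀) := by
    intro hl
    rw [Real.exp_le_exp, neg_le_neg_iff]
    have hL0 : (0 : ℝ) ≤ L := Nat.cast_nonneg L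
    calc ((L : ℝ) * R) ^ η₀ = (L : ℝ) ^ η₀ * (R : ℝ) ^ η₀ := Real.mul_rpow hL0 hR0.le
      _ ≤ ((R : ℝ) ^ ((l : ℝ) / d)) ^ η₀ * (R : ℝ) ^ η₀ :=
          mul_le_mul_of_nonneg_right (Real.rpow_le_rpow hL0 (hLle hl) hη₀0.le)
            (Real.rpow_nonneg hR0.le _)
      _ = (R : ℝ) ^ (((l : ℝ) / d + 1) * η₀) := by
          rw [← Real.rpow_mul hR0.le, ← Real.rpow_add hR0]
          congr 1; ring
      _ = (R : ℝ) ^ η := by rw [hη₀, exponent_identity hd η]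
  have hclose : l ≠ 0 → ∀ i j, ‖exp ((x i : ℂ) * y j) - μ i j‖ < Real.exp (-((L : ℝ) * R) ^ η₀) :=
    fun hl i j => (hμ i j).trans_le (hscale hl)
  -- (d) the finite set `Σ₀ = {σ_r ; rⱼ < N}`, `N = ⌈R/d⌉`, inside the torus
  set N : ℕ := ⌈(R : ℝ) / d⌉₊ with hN
  have hN1 : 1 ≤ N := Nat.one_le_ceil_iff.mpr (by positivity)
  have hNR : N ≤ R := Nat.ceil_le.mpr (by exact_mod_cast hRd)
  have hNlt : ((N : ℝ) - 1) < (R : ℝ) / d := by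
    have := Nat.ceil_lt_add_one hRdnn
    linarith
  set box : Finset (Fin l → ℕ) := Fintype.piFinset fun _ : Fin l => range N with hbox
  set SF : Finset (Torus d) := box.image σu with hSF
  have hmem_box : ∀ {r : Fin l → ℕ}, r ∈ box ↔ ∀ j, r j < N := fun {r} => by
    simp only [hbox, Fintype.mem_piFinset, mem_range]
  have hσu0 : σu 0 = 1 := by ext i; simp [hσu]
  have h1S : (1 : Torus d) ∈ (SF : Set (Torus d)) := by
    rw [mem_coe, hSF, mem_image]
    exact ⟨0, hmem_box.mpr fun _ => hN1, hσu0⟩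
  -- `P` vanishes on `Σ₀(d) ⊆ Σ_R`
  have hvan : ∀ g ∈ prodSet (SF : Set (Torus d)) d, aevalAt P g = 0 := by
    rintro g ⟨τ, hτ, rfl⟩
    have hτ' : ∀ k, ∃ r ∈ box, σu r = τ k := fun k => by
      have := hτ k
      rw [mem_coe, hSF, mem_image] at this
      exact this
    choose r hrbox hrτ using hτ'
    have hg : ∏ k, τ k = σu (∑ k, r k) := by
      rw [show σu (∑ k, r k) = ∏ k, σu (r k) from torusGrid_sum ν r]
      exact prod_congr rfl fun k _ => (hrτ k).symm
    rw [hg, aevalAt, hcoeσ]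
    refine hPv _ ⟨∑ k, r k, fun j => ?_, rfl⟩
    -- `∑ₖ rₖ j ≤ d (N - 1) < R`
    have h1 : (∑ k, r k) j ≤ d * (N - 1) := by
      rw [Finset.sum_apply]
      calc ∑ k, r k j ≤ ∑ _k : Fin d, (N - 1) := sum_le_sum fun k _ => by
            have := (hmem_box.mp (hrbox k)) j
            omega
        _ = d * (N - 1) := by simp
    have h2 : ((d * (N - 1) : ℕ) : ℝ) < R := by
      push_cast [Nat.cast_sub hN1]
      calc (d : ℝ) * ((N : ℝ) - 1) < d * ((R : ℝ) / d) := mul_lt_mul_of_pos_left hNlt hd0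
        _ = R := mul_div_cancel₀ _ hd0.ne'
    have h3 : d * (N - 1) < R := by exact_mod_cast h2
    omega
  -- (e) the zero estimate: a character `a`; `a`-separated subsets of `Σ₀` have `≤ D^d` points
  obtain ⟨a, ha0, haD, hcard⟩ := Philippon1986_zeroEstimate_torus.exists_char hZ hd
    (SF.finite_toSet) h1S hP0 hPdeg.le hvan
  have haL : ∀ i, |a i| ≤ (L : ℤ) := fun i => (haD i).trans (by exact_mod_cast le_max_right L₀ D)
  -- Lemma 3.5: distinct exponents in the box give `λ`-separated (in particular distinct) points
  have hsep_box : ∀ r ∈ box, ∀ r' ∈ box, r ≠ r' → char a ((σu r)⁻¹ * σu r') ≠ 1 := by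
    intro r hr r' hr' hne hchar
    have hl : l ≠ 0 := by
      rintro rfl
      exact hne (Subsingleton.elim r r')
    have hrr : (fun j => (r' j : ℤ) - r j) ≠ 0 := by
      intro h0
      apply hne
      exact funext fun j => by
        have := congrFun h0 j
        simp only [Pi.zero_apply, sub_eq_zero] at this
        exact_mod_cast this.symm
    have hrR : ∀ j, |(r' j : ℤ) - r j| ≤ (R : ℤ) := fun j => by
      have h1 := (hmem_box.mp hr) j
      have h2 := (hmem_box.mp hr') j
      rw [abs_le]
      constructor <;> omega
    have key := h35 L R (le_max_left _ _) hRR₀ μ (hclose hl) a (fun j => (r' j : ℤ) - r j)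
      ha0 hrr haL hrR
    apply key
    have := congrArg (fun u : ℂˣ => (u : ℂ)) hchar
    simpa only [hσu, coe_char_torusGrid_inv_mul, hνμ, Units.val_one] using this
  have hinj : Set.InjOn σu (box : Set (Fin l → ℕ)) := by
    intro r hr r' hr' heq
    by_contra hne
    refine hsep_box r (mem_coe.mp hr) r' (mem_coe.mp hr') hne ?_
    rw [heq, inv_mul_cancel, map_one]
  have hsep : ∀ σ ∈ SF, ∀ σ' ∈ SF, σ ≠ σ' → char a (σ⁻¹ * σ') ≠ 1 := by
    intro σ hσ σ' hσ' hne
    rw [hSF, mem_image] at hσ hσ'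
    obtain ⟨r, hr, rfl⟩ := hσ
    obtain ⟨r', hr', rfl⟩ := hσ'
    exact hsep_box r hr r' hr' (fun h => hne (by rw [h]))
  have hcardle : SF.card ≤ D ^ d := hcard SF subset_rfl hsep
  have hcardSF : SF.card = N ^ l := by
    rw [hSF, card_image_of_injOn hinj, hbox, Fintype.card_piFinset, prod_const, card_range,
      card_univ, Fintype.card_fin]
  -- (f) the numerical contradiction `N^ℓ ≤ D^d < (R/d)^ℓ ≤ N^ℓ`
  have h1 : ((N : ℝ)) ^ l ≤ (D : ℝ) ^ d := by exact_mod_cast hcardSF ▸ hcardle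
  have h2 : (D : ℝ) ^ d < ((R : ℝ) / d) ^ l := by
    have := pow_lt_pow_left₀ hDlt (Nat.cast_nonneg D) (show d ≠ 0 by omega)
    rwa [← Real.rpow_natCast (((R : ℝ) / d) ^ ((l : ℝ) / d)) d, ← Real.rpow_mul hRdnn,
      div_mul_cancel₀ _ hd0.ne', Real.rpow_natCast] at this
  have h3 : ((R : ℝ) / d) ^ l ≤ (N : ℝ) ^ l := pow_le_pow_left₀ hRdnn (Nat.le_ceil _) l
  linarith

end Literature.NumberTheory.Transcendental

end
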